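import Literature.MathematicalPhysics.QuantumFieldTheory.Balaban1983to89.T4MultilevelCombLocal

/-!
# T4 — NE1′ / O-G1′: the multilevel comb gauge of the UNITARY PARTS carries FACTORISED (complexified) pairs

Literature layer, kernel-checked, tree-first (cell `pub-balaban`, row `T4-O3.E-NE1′-OG1′-MULTILEVEL-FACT*`, owner
lineage `pv04`; parents `T4MultilevelCombGauge` (the multilevel rooted comb gauge `multiComb`), `T4MultilevelCombRegular`
(the `k`-uniform bound `multilevel_bound_regular_dconst` under (52)-FORMAT regularity `FineRegular`),
`T4MultilevelCombLocal` (its LOCAL form `multilevel_bound_regular_local_dconst`, hypotheses on the two top blocks over the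
bond) and, through `T4BlockwiseCombGauge`, `T4RelativeCombFactorisedPatch` / `T4RelativeCombWindow` §7 (the FACTORISED
RESPONSE: pairs `𝐔ᵢ = Wᵢ ⊙ Uᵢ`, `fmul`, unitary-like parts `Uᵢ`, complex factors `Wᵢ` as DATA, gauged by a gauge of the
unitary parts)).

WHAT THIS FILE DOES.  §1 proves a second, `γ`-FREE form of the factorised response (`norm_factorised_sub_one_le_abs`,
`factorised_bound_gauge_abs`): for ANY gauge field `g` unitary-like at the site `x` and the bond `b = ⟨x, x + e_ν⟩`,
`‖pert(𝐔₀, 𝐔₁^g)(b) − 1‖ ≤ M·(n₁·δ + t₁ + t₀)` from the UNITARY relative deviation `δ ≥ ‖(U₁^g)(b)·U₀(b)⁻¹ − 1‖` and the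
ABSOLUTE window data `‖W₁(b)‖ ≤ n₁`, `‖W₁(b) − 1‖ ≤ t₁`, `‖W₀(b) − 1‖ ≤ t₀`, `‖W₀(b)⁻¹‖ ≤ M` — the transport size
`‖g_x − 1‖` does NOT enter (the landed form `T4RelativeCombFactorisedPatch.factorised_bound_gauge` is
`M·(n₁·δ + w + 2·γ·t₀)` with the RELATIVE datum `w ≥ ‖W₁(b) − W₀(b)‖` and `γ ≥ ‖g_x − 1‖`; it is the better one exactly when
`w + 2γt₀ < t₁ + t₀`, i.e. when `W₁` tracks `W₀` and the transport is small).  §2 bounds the TRANSPORT SIZE of the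
multilevel gauge (`norm_multiComb_sub_one_le`): `‖g_x − 1‖ ≤ d·(P_k − 1)·ε + τ` for the scales `L₁, …, L_k ≥ 1`,
`P_k = L₁⋯L_k`, `ε ≥ ‖U₁ − U₀‖` bondwise (a FREE, gauge-variant input) and `τ ≥ ‖hTop − 1‖` — LINEAR in the side of the
top block, first order (the explicit formula `rooted_site`, one `T4RelativeComb.norm_relGauge_sub_one_le` per level,
the coarse bond deviation `‖scaled L U₁ − scaled L U₀‖ ≤ L·ε`, and the telescoping identity `Σ_j (L_{j+1} − 1)·P_j =
P_k − 1`).  §3 combines: in the multilevel comb gauge `g = multiComb Ls hTop U₀ U₁` OF THE UNITARY PARTS, on every bond,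
`‖pert(𝐔₀, 𝐔₁^g)(b) − 1‖ ≤ M·(n₁·δ_b + t₁ + t₀)` (absolute data) resp. `≤ M·(n₁·δ_b + w + 2·(d(P_k − 1)ε + τ)·t₀)` (relative
data), `δ_b` ANY bound of the parents for the unitary parts — in particular the `k`-UNIFORM, `L`-FREE one
`(d−1)(2d−1)·(a₁ + a₀) + X` of `T4MultilevelCombRegular` (`factorised_multilevel_bound_regular_abs/_rel`) — and, for a
UNITARY BACKGROUND `W₀ = 1` (a complexified `𝐔₁` in a window around a 𝔊-valued regular `U₀`), `≤ n₁·δ_b + t₁ ≤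
(1 + t₁)·δ_b + t₁` with NO transport term and NO `ε` hypothesis at all (`window_bound_multiComb`,
`window_multilevel_bound_regular`).  §4 gives the LOCAL forms over `T4MultilevelCombLocal` (curvature hypotheses on the two
top blocks over `b`, the one top bond, the complex factors at the ONE bond `b`).  §5: consistency (`W₀ = W₁ = 1` returns
the unitary bound), non-vacuity, and SHARPNESS of the coefficient of `t₁` (the flat pair with a constant complex factor
attains the window bound).

PRINTED STATUS.  NOTHING printed enters any declaration; every declaration is [folklore] and kernel-proved.  CONTEXT
ONLY (no sentence of any paper is used; the loci are those already quoted verbatim, from renders read by this lineage, in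
the headers of `T4RelativeCombWindow` v1.1/v1.4 and `T4RelativeCombFactorisedPatch` v1.2, and are re-keyed from there):
complexified configurations are FACTORISED «𝐔 = U′U, U has values in the group G» ([Balaban1987RG1] (1.11) p. 262), the
factor near `1` carried with linear first-order bounds; a complex perturbation `V′V₀` of a regular unitary `V₀` is taken
as the reference of the relative block axial gauges at the printed ONE-LEVEL price «the constant e^{O(1)L²α₀} on the
right-hand side is replaced by e^{O(1)(L²α₀+Lα₁)}» ([Balaban1985Averaging] p. 43, the paragraph before Proposition 7;
GAPS A-t4lit1-3b).  The cell-side question this file answers in kernel form is the NE1′ estimate record's worry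
(HOME/t4/T4-EST-NE1p-P1.md, (O2)(I4)) that an O-G1′-type gauge built by transports over a region of side `R` costs a
conjugation factor growing with `R` which the complex window must absorb: in the sup-norm FACTORISED format the gauge is
built from the unitary parts only, conjugation by it is an isometry of `‖· − 1‖` (`T4RelativeLadder.norm_conj_sub_one_eq`),
and the cost of the complex factors is `M·(t₁ + t₀)`, INDEPENDENT of `R` and of the number of levels; only if one insists
on the relative datum `w` does the transport size enter, linearly (`2·(d(P_k − 1)ε + τ)·t₀`), never exponentially.  No
cited-fact binder, no summit-side statement.  The cite tags below are the imported files'.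

HONEST SCOPE.  (i) Sup norms, `ℤ^d` as the whole lattice (the local forms of §4 are local in the sense of
`T4MultilevelCombLocal`: the block tower over the bond); unitary-like parts, unitary-like top gauge; the complex factors
are DATA (`fmul`), nothing factorises a given complex configuration, no exponential map, no curvature of the full `𝐔`.
(ii) The coarse variables are the STRAIGHT transports `scaled`, not Bałaban's averages; `hTop`, `X` (resp. the one top
bond) are free inputs; the bond deviation `ε` of §2 is a free, gauge-VARIANT input (small only for a pair PRESENTED close,
e.g. print's `U′U` against `U`), used only by the `_rel` statements.  (iii) `M·(t₁ + t₀)` is the trivial price of not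
gauging the complex factors at all: the file shows that the multilevel gauge does not make it WORSE, not that any gauge
makes it better; the complex factor of `𝐔₁` is conjugated, never gauged away.  (iv) Uniform scale list `replicate k L`,
`L ≥ 2`, for the closed-form constants (general lists `Ls` for §2 and the generic transfers of §3).  (v) NO statement
about Hölder norms, averaging operations, windows of analyticity, Landau gauge or renormalization transformations.
Value = kernel bookkeeping (two short algebraic lemmas on top of three accepted leaves); NOT an estimate of print's, NOT
summit progress.

v1.1 (§6, APPEND-ONLY; v1's declarations unchanged).  ONE-BLOCK CONSUMER FORMS: §1 specialised to the one-block relative comb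
gauge `combGauge U₀ U₁ z` of `T4RelativeComb`, stated in the EXACT left-hand-side formats and hypothesis lists of
`T4RelativeCombWindow.factorised_interior_bound_crude` / `_fine` (`‖((𝐔₁^g)(b)·𝐔₀(b)⁻¹ : Rˣ) − 1‖`) and of the consumer
`T4BlockTransport.factorised_bond_bound` (`‖(𝐔₁^g)(b) − 𝐔₀(b)‖ ≤ n₀·(…)`, the shape `block_transport` takes through `hCδ`):
absolute data `M·(n₁·δ + t₁ + t₀)`; UNCHANGED relative data `M·(n₁·δ + w + 2·t₀)` in place of Window-crude's `… + w + 4·t₀`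
(drop-in, same hypotheses in the same order; against Window-FINE's `… + w + 2·(d(L−1)ε)·t₀` it is better iff `d(L−1)ε > 1` —
honest: with small transport the fine relative form keeps the edge; the gain of the `γ`-free forms is `L`-independence).
Consumers' files are not touched; nothing printed; [folklore].
-/

namespace Literature.MathematicalPhysics.QuantumFieldTheory.Balaban1983to89.T4MultilevelCombFactorised

open Finset
open B8Lemma1Lattice (e site InBlock exists_offset_of_inBlock)
open T4RelativeLadder (UnitaryLike norm_conj_sub_one_eq norm_unit_mul_le norm_mul_unit_le)
open T4RelativeComb (Cfg gaugeAct plaq hol relGauge unitaryLike_hol norm_relGauge_sub_one_le sum_le)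
open T4RelativeCombWindow (fmul norm_le_one_add_of_norm_sub_one_le)
open T4RelativeCombCrossing (pert crossConst)
open T4RelativeCombFactorisedPatch (factorised_pert_eq factorised_bound_gauge)
open T4BlockwiseCombGauge (corner isCorner_corner inBlock_corner)
open T4MultilevelCombGauge (blockIndex cornerOf scaled rooted rooted_site multiComb multiComb_cons multiComb_nil
  unitaryLike_multiComb unitaryLike_scaled hol_line_eq_one)
open T4MultilevelCombRegular (FineRegular multilevel_bound_regular_dconst)
open T4MultilevelCombLocal (FineRegularOn fineRegularOn_of_fineRegular multilevel_bound_regular_local_dconst)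

variable {R : Type*} [NormedRing R] {d : ℕ}

/-- [folklore] Local shorthand for the site lattice `ℤ^d` (the carrier of `T4MultilevelCombGauge.Site d`, definitionally). -/
abbrev Site (d : ℕ) : Type := Fin d → ℤ

example (d : ℕ) : Site d = T4MultilevelCombGauge.Site d := rfl

/-! ## §1  The factorised response with ABSOLUTE window data: no transport term -/

/-- [folklore] `‖A·D − 1‖ ≤ ‖A‖·‖D − 1‖ + ‖A − 1‖` (`A·D − 1 = A·(D − 1) + (A − 1)`). -/
theorem norm_mul_sub_one_le (A D : R) : ‖A * D - 1‖ ≤ ‖A‖ * ‖D - 1‖ + ‖A - 1‖ := by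
  have e1 : A * D - 1 = A * (D - 1) + (A - 1) := by noncomm_ring
  rw [e1]
  exact (norm_add_le _ _).trans (add_le_add (norm_mul_le _ _) le_rfl)

/-- [folklore] `‖W⁻¹ − 1‖ ≤ ‖W⁻¹‖·‖W − 1‖` (`W⁻¹ − 1 = W⁻¹·(1 − W)`). -/
theorem norm_inv_sub_one_le (W : Rˣ) : ‖((W⁻¹ : Rˣ) : R) - 1‖ ≤ ‖((W⁻¹ : Rˣ) : R)‖ * ‖(W : R) - 1‖ := by
  have e1 : ((W⁻¹ : Rˣ) : R) - 1 = ((W⁻¹ : Rˣ) : R) * (1 - (W : R)) := by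
    rw [mul_sub, mul_one, Units.inv_mul]
  rw [e1]
  calc _ ≤ ‖((W⁻¹ : Rˣ) : R)‖ * ‖1 - (W : R)‖ := norm_mul_le _ _
    _ = _ := by rw [norm_sub_rev]

/-- [folklore] **THE `γ`-FREE FACTORISED RESPONSE (norm inequality)**: for a unitary-like unit `g`, units `W₁, W₀` and
any `D`, `‖(g·W₁·g⁻¹)·D·W₀⁻¹ − 1‖ ≤ (‖W₁‖·‖D − 1‖ + ‖W₁ − 1‖ + ‖W₀ − 1‖)·‖W₀⁻¹‖` — from
`(gW₁g⁻¹)DW₀⁻¹ − 1 = ((gW₁g⁻¹)D − 1)·W₀⁻¹ + (W₀⁻¹ − 1)`, `‖gW₁g⁻¹‖ ≤ ‖W₁‖` and the ISOMETRY `‖gW₁g⁻¹ − 1‖ = ‖W₁ − 1‖`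
(`T4RelativeLadder.norm_conj_sub_one_eq`): the size `‖g − 1‖` of the conjugator never enters.  Compare
`T4RelativeCombWindow.norm_factorised_sub_one_le`: `(‖W₁‖·‖D − 1‖ + ‖W₁ − W₀‖ + 2·‖g − 1‖·‖W₀ − 1‖)·‖W₀⁻¹‖`. -/
theorem norm_factorised_sub_one_le_abs {g W₁ W₀ : Rˣ} (hg : UnitaryLike g) (D : R) :
    ‖(g : R) * W₁ * ↑g⁻¹ * D * ↑W₀⁻¹ - 1‖ ≤
      (‖(W₁ : R)‖ * ‖D - 1‖ + ‖(W₁ : R) - 1‖ + ‖(W₀ : R) - 1‖) * ‖((W₀⁻¹ : Rˣ) : R)‖ := by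
  set A : R := (g : R) * W₁ * ↑g⁻¹ with hA
  have e1 : A * D * ↑W₀⁻¹ - 1 = (A * D - 1) * ↑W₀⁻¹ + (((W₀⁻¹ : Rˣ) : R) - 1) := by noncomm_ring
  rw [e1]
  have hA1 : ‖A‖ ≤ ‖(W₁ : R)‖ := (norm_mul_unit_le hg.inv _).trans (norm_unit_mul_le hg _)
  have hA2 : ‖A - 1‖ = ‖(W₁ : R) - 1‖ := norm_conj_sub_one_eq hg _
  have hAD : ‖A * D - 1‖ ≤ ‖(W₁ : R)‖ * ‖D - 1‖ + ‖(W₁ : R) - 1‖ := by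
    calc ‖A * D - 1‖ ≤ ‖A‖ * ‖D - 1‖ + ‖A - 1‖ := norm_mul_sub_one_le A D
      _ ≤ _ := by rw [hA2]; exact add_le_add (mul_le_mul_of_nonneg_right hA1 (norm_nonneg _)) le_rfl
  calc ‖(A * D - 1) * ↑W₀⁻¹ + (((W₀⁻¹ : Rˣ) : R) - 1)‖
      ≤ ‖A * D - 1‖ * ‖((W₀⁻¹ : Rˣ) : R)‖ + ‖((W₀⁻¹ : Rˣ) : R)‖ * ‖(W₀ : R) - 1‖ :=
        (norm_add_le _ _).trans (add_le_add (norm_mul_le _ _) (norm_inv_sub_one_le W₀))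
    _ ≤ (‖(W₁ : R)‖ * ‖D - 1‖ + ‖(W₁ : R) - 1‖) * ‖((W₀⁻¹ : Rˣ) : R)‖
          + ‖((W₀⁻¹ : Rˣ) : R)‖ * ‖(W₀ : R) - 1‖ :=
        add_le_add (mul_le_mul_of_nonneg_right hAD (norm_nonneg _)) le_rfl
    _ = _ := by ring

/-- [folklore] **THE FACTORISED RESPONSE FOR AN ARBITRARY GAUGE FIELD, ABSOLUTE WINDOW DATA**: for `g` unitary-like at
`x` and the bond `b = ⟨x, x + e_ν⟩`, `‖pert(𝐔₀, 𝐔₁^g)(b) − 1‖ ≤ M·(n₁·δ + t₁ + t₀)` whenever the UNITARY relative bond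
variable has `‖pert(U₀, U₁^g)(b) − 1‖ ≤ δ` and `‖W₁(b)‖ ≤ n₁`, `‖W₁(b) − 1‖ ≤ t₁`, `‖W₀(b) − 1‖ ≤ t₀`, `‖W₀(b)⁻¹‖ ≤ M`
(`factorised_pert_eq` + `norm_factorised_sub_one_le_abs`).  No hypothesis on `‖g_x − 1‖`. -/
theorem factorised_bound_gauge_abs [NormOneClass R] {g : Site d → Rˣ} {U₀ U₁ W₀ W₁ : Cfg d R} {x : Site d}
    {ν : Fin d} {δ n₁ t₁ t₀ M : ℝ} (hg : UnitaryLike (g x))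
    (hδ : ‖(pert U₀ (gaugeAct g U₁) x ν : R) - 1‖ ≤ δ)
    (hn₁ : ‖(W₁ x ν : R)‖ ≤ n₁) (ht₁ : ‖(W₁ x ν : R) - 1‖ ≤ t₁) (ht₀ : ‖(W₀ x ν : R) - 1‖ ≤ t₀)
    (hM : ‖(((W₀ x ν)⁻¹ : Rˣ) : R)‖ ≤ M) :
    ‖(pert (fmul W₀ U₀) (gaugeAct g (fmul W₁ U₁)) x ν : R) - 1‖ ≤ M * (n₁ * δ + t₁ + t₀) := by
  rw [factorised_pert_eq]
  push_cast
  have h := norm_factorised_sub_one_le_abs (W₁ := W₁ x ν) (W₀ := W₀ x ν) hg (pert U₀ (gaugeAct g U₁) x ν : R)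
  have e1 : ‖(W₁ x ν : R)‖ * ‖(pert U₀ (gaugeAct g U₁) x ν : R) - 1‖ ≤ n₁ * δ :=
    mul_le_mul hn₁ hδ (norm_nonneg _) ((norm_nonneg _).trans hn₁)
  have hsum : ‖(W₁ x ν : R)‖ * ‖(pert U₀ (gaugeAct g U₁) x ν : R) - 1‖ + ‖(W₁ x ν : R) - 1‖
      + ‖(W₀ x ν : R) - 1‖ ≤ n₁ * δ + t₁ + t₀ :=
    add_le_add (add_le_add e1 ht₁) ht₀
  have h0 : 0 ≤ ‖(W₁ x ν : R)‖ * ‖(pert U₀ (gaugeAct g U₁) x ν : R) - 1‖ + ‖(W₁ x ν : R) - 1‖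
      + ‖(W₀ x ν : R) - 1‖ := by positivity
  calc _ ≤ _ := h
    _ ≤ (n₁ * δ + t₁ + t₀) * M := mul_le_mul hsum hM (norm_nonneg _) (h0.trans hsum)
    _ = M * (n₁ * δ + t₁ + t₀) := mul_comm _ _

/-- [folklore] The same with the two DISTANCES TO `1` only (`t₀ < 1`): `‖W₁‖ ≤ 1 + t₁`
(`T4RelativeCombWindow.norm_le_one_add_of_norm_sub_one_le`) and `‖W₀⁻¹‖ ≤ (1 − t₀)⁻¹` (the a-priori Neumann bound
`T4RelativeCombWindow.NearUnitary.of_norm_sub_one_le`) give `≤ (1 − t₀)⁻¹·((1 + t₁)·δ + t₁ + t₀)`.  Compare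
`T4RelativeCombWindow.factorised_bound_abs`: `(1 − t₀)⁻¹·((1 + t₁)·δ + (t₁ + t₀) + 2·γ·t₀)`. -/
theorem factorised_bound_gauge_abs' [NormOneClass R] {g : Site d → Rˣ} {U₀ U₁ W₀ W₁ : Cfg d R} {x : Site d}
    {ν : Fin d} {δ t₁ t₀ : ℝ} (hg : UnitaryLike (g x))
    (hδ : ‖(pert U₀ (gaugeAct g U₁) x ν : R) - 1‖ ≤ δ)
    (ht₁ : ‖(W₁ x ν : R) - 1‖ ≤ t₁) (ht₀ : ‖(W₀ x ν : R) - 1‖ ≤ t₀) (ht₀1 : t₀ < 1) :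
    ‖(pert (fmul W₀ U₀) (gaugeAct g (fmul W₁ U₁)) x ν : R) - 1‖ ≤ (1 - t₀)⁻¹ * ((1 + t₁) * δ + t₁ + t₀) :=
  factorised_bound_gauge_abs hg hδ (norm_le_one_add_of_norm_sub_one_le ht₁) ht₁ ht₀
    (T4RelativeCombWindow.NearUnitary.of_norm_sub_one_le ht₀ ht₀1).2

/-! ## §2  Transport size of the multilevel comb gauge: LINEAR in the side of the top block -/

/-- [folklore] `‖a⁻¹·c·b − 1‖ ≤ ‖c − 1‖ + ‖a⁻¹·b − 1‖` for unitary-like `a, b` and any unit `c`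
(`a⁻¹cb − 1 = a⁻¹(c − 1)b + (a⁻¹b − 1)`, `‖a⁻¹‖, ‖b‖ ≤ 1`). -/
theorem norm_conj_transport_sub_one_le {a b : Rˣ} (ha : UnitaryLike a) (hb : UnitaryLike b) (c : Rˣ) :
    ‖((a⁻¹ * c * b : Rˣ) : R) - 1‖ ≤ ‖(c : R) - 1‖ + ‖((a⁻¹ * b : Rˣ) : R) - 1‖ := by
  have e1 : ((a⁻¹ * c * b : Rˣ) : R) - 1 =
      ((a⁻¹ : Rˣ) : R) * ((c : R) - 1) * b + (((a⁻¹ * b : Rˣ) : R) - 1) := by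
    push_cast; noncomm_ring
  rw [e1]
  refine (norm_add_le _ _).trans (add_le_add ?_ le_rfl)
  calc ‖((a⁻¹ : Rˣ) : R) * ((c : R) - 1) * b‖ ≤ ‖((a⁻¹ : Rˣ) : R) * ((c : R) - 1)‖ := norm_mul_unit_le hb _
    _ ≤ ‖(c : R) - 1‖ := norm_unit_mul_le ha.inv _

/-- [folklore] STAIRCASE TRANSPORTS OF TWO CLOSE CONFIGURATIONS ARE CLOSE: if `‖U₁ − U₀‖ ≤ ε` bondwise (`U₀`, `U₁`
unitary-like) then `‖U₁(Γ_{z,z+k}) − U₀(Γ_{z,z+k})‖ ≤ |k|₁·ε` (`U₁(Γ) − U₀(Γ) = U₀(Γ)·(U₀(Γ)⁻¹U₁(Γ) − 1)` and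
`T4RelativeComb.norm_relGauge_sub_one_le` on a block containing the path). -/
theorem norm_hol_sub_hol_le [NormOneClass R] {U₀ U₁ : Cfg d R} {ε : ℝ} (hU₀ : ∀ x ν, UnitaryLike (U₀ x ν))
    (hU₁ : ∀ x ν, UnitaryLike (U₁ x ν)) (hdev : ∀ x ν, ‖(U₁ x ν : R) - U₀ x ν‖ ≤ ε) (z : Site d)
    (k : Fin d → ℕ) : ‖(hol U₁ z k : R) - hol U₀ z k‖ ≤ ((∑ ρ, k ρ : ℕ) : ℝ) * ε := by
  have e1 : (hol U₁ z k : R) - hol U₀ z k = (hol U₀ z k : R) * ((relGauge U₀ U₁ z k : R) - 1) := by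
    rw [relGauge, Units.val_mul, mul_sub, mul_one, ← mul_assoc, Units.mul_inv, one_mul]
  rw [e1]
  have hk : ∀ κ, k κ < ∑ ρ, k ρ + 1 := fun κ =>
    Nat.lt_succ_of_le (Finset.single_le_sum (fun ρ _ => Nat.zero_le (k ρ)) (Finset.mem_univ κ))
  calc _ ≤ ‖(relGauge U₀ U₁ z k : R) - 1‖ := norm_unit_mul_le (unitaryLike_hol hU₀ z k) _
    _ ≤ ((∑ ρ, k ρ : ℕ) : ℝ) * ε :=
        norm_relGauge_sub_one_le (L := ∑ ρ, k ρ + 1) hU₀ (fun x ν => (hU₁ x ν).1) (fun x ν _ _ => hdev x ν) k hk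

/-- [folklore] THE COARSE BOND DEVIATION: `‖(scaled L U₁)⟨y′, ν⟩ − (scaled L U₀)⟨y′, ν⟩‖ ≤ L·ε` (a straight segment of
`L` bonds). -/
theorem norm_scaled_sub_scaled_le [NormOneClass R] {U₀ U₁ : Cfg d R} {ε : ℝ} (hU₀ : ∀ x ν, UnitaryLike (U₀ x ν))
    (hU₁ : ∀ x ν, UnitaryLike (U₁ x ν)) (hdev : ∀ x ν, ‖(U₁ x ν : R) - U₀ x ν‖ ≤ ε) (L : ℕ) (y' : Site d)
    (ν : Fin d) : ‖(scaled L U₁ y' ν : R) - scaled L U₀ y' ν‖ ≤ (L : ℝ) * ε := by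
  have h := norm_hol_sub_hol_le hU₀ hU₁ hdev (cornerOf L y') (Pi.single ν L)
  have hs : ∑ ρ, (Pi.single ν L : Fin d → ℕ) ρ = L := by simp [Finset.sum_pi_single']
  rw [hs] at h
  exact h

/-- [folklore] TRANSPORT SIZE OF THE ROOTED GAUGE: if `‖U₁ − U₀‖ ≤ ε` bondwise (`ε ≥ 0`) and the root values satisfy
`‖h − 1‖ ≤ τ`, then `‖g_x − 1‖ ≤ d(L−1)·ε + τ` for `g = rooted L h U₀ U₁` and every site `x` (the explicit formula
`T4MultilevelCombGauge.rooted_site` `g(y+k) = U₀(Γ_{y,y+k})⁻¹·h(⌊y/L⌋)·U₁(Γ_{y,y+k})`, `norm_conj_transport_sub_one_le`, and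
`‖U₀(Γ)⁻¹U₁(Γ) − 1‖ ≤ |k|₁·ε ≤ d(L−1)·ε` on the block). -/
theorem norm_rooted_sub_one_le [NormOneClass R] {U₀ U₁ : Cfg d R} {h : Site d → Rˣ} {L : ℕ} {ε τ : ℝ}
    (hU₀ : ∀ x ν, UnitaryLike (U₀ x ν)) (hU₁ : ∀ x ν, UnitaryLike (U₁ x ν)) (hL : 1 ≤ L) (hε : 0 ≤ ε)
    (hdev : ∀ x ν, ‖(U₁ x ν : R) - U₀ x ν‖ ≤ ε) (hτ : ∀ y', ‖(h y' : R) - 1‖ ≤ τ) (x : Site d) :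
    ‖(rooted L h U₀ U₁ x : R) - 1‖ ≤ (d : ℝ) * ((L : ℝ) - 1) * ε + τ := by
  obtain ⟨k, hk, hx⟩ := exists_offset_of_inBlock (inBlock_corner hL x)
  have hrel : ‖(((hol U₀ (corner L x) k)⁻¹ * hol U₁ (corner L x) k : Rˣ) : R) - 1‖ ≤
      (d : ℝ) * ((L : ℝ) - 1) * ε :=
    calc _ ≤ ((∑ ρ, k ρ : ℕ) : ℝ) * ε :=
          norm_relGauge_sub_one_le hU₀ (fun x ν => (hU₁ x ν).1) (fun x ν _ _ => hdev x ν) k hk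
      _ ≤ _ := mul_le_mul_of_nonneg_right (sum_le hk) hε
  rw [← hx, rooted_site hL (isCorner_corner L x) h U₀ U₁ k hk]
  calc _ ≤ ‖(h (blockIndex L (corner L x)) : R) - 1‖
        + ‖(((hol U₀ (corner L x) k)⁻¹ * hol U₁ (corner L x) k : Rˣ) : R) - 1‖ :=
        norm_conj_transport_sub_one_le (unitaryLike_hol hU₀ _ k) (unitaryLike_hol hU₁ _ k) _
    _ ≤ τ + (d : ℝ) * ((L : ℝ) - 1) * ε := add_le_add (hτ _) hrel
    _ = _ := add_comm _ _

/-- [folklore] **TRANSPORT SIZE OF THE MULTILEVEL COMB GAUGE**: for scales `L₁, …, L_k ≥ 1` (finest first),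
`P_k = L₁⋯L_k`, a unitary-like pair with `‖U₁ − U₀‖ ≤ ε` bondwise (`ε ≥ 0`) and a top gauge with `‖hTop − 1‖ ≤ τ`:
`‖g_x − 1‖ ≤ d·(P_k − 1)·ε + τ` at every site (induction on the list: `norm_rooted_sub_one_le` at the finest scale with
the bound for the coarse pair — bond deviation `L₁·ε`, `norm_scaled_sub_scaled_le` — as root data; the telescoping
identity `(L₁ − 1) + L₁·(P′ − 1) = P_k − 1`).  LINEAR in the side of the top block; first order. -/
theorem norm_multiComb_sub_one_le [NormOneClass R] (Ls : List ℕ) :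
    ∀ {U₀ U₁ : Cfg d R} {hTop : Site d → Rˣ} {ε τ : ℝ},
      (∀ x ν, UnitaryLike (U₀ x ν)) → (∀ x ν, UnitaryLike (U₁ x ν)) → (∀ L ∈ Ls, 1 ≤ L) → 0 ≤ ε →
      (∀ x ν, ‖(U₁ x ν : R) - U₀ x ν‖ ≤ ε) → (∀ z, ‖(hTop z : R) - 1‖ ≤ τ) →
      ∀ x, ‖(multiComb Ls hTop U₀ U₁ x : R) - 1‖ ≤ (d : ℝ) * (((Ls.prod : ℕ) : ℝ) - 1) * ε + τ := by
  induction Ls with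
  | nil =>
      intro U₀ U₁ hTop ε τ _ _ _ _ _ hτ x
      rw [multiComb_nil]
      have h := hτ x
      simpa using h
  | cons L Ls ih =>
      intro U₀ U₁ hTop ε τ hU₀ hU₁ hLs hε hdev hτ x
      have hL : 1 ≤ L := hLs L (List.mem_cons.2 (Or.inl rfl))
      have hLs' : ∀ L' ∈ Ls, 1 ≤ L' := fun L' h => hLs L' (List.mem_cons.2 (Or.inr h))
      rw [multiComb_cons]
      have hcoarse := ih (unitaryLike_scaled hU₀ L) (unitaryLike_scaled hU₁ L) hLs'
        (mul_nonneg (Nat.cast_nonneg L) hε) (fun y' ν => norm_scaled_sub_scaled_le hU₀ hU₁ hdev L y' ν) hτ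
      calc _ ≤ (d : ℝ) * ((L : ℝ) - 1) * ε + ((d : ℝ) * (((Ls.prod : ℕ) : ℝ) - 1) * ((L : ℝ) * ε) + τ) :=
            norm_rooted_sub_one_le hU₀ hU₁ hL hε hdev hcoarse x
        _ = (d : ℝ) * ((((L :: Ls).prod : ℕ) : ℝ) - 1) * ε + τ := by
            rw [List.prod_cons]; push_cast; ring

/-- [folklore] On the uniform list `[L, …, L]` (`k` entries, `L ≥ 1`): `‖g_x − 1‖ ≤ d·(L^k − 1)·ε + τ`. -/
theorem norm_multiComb_replicate_sub_one_le [NormOneClass R] (L k : ℕ) {U₀ U₁ : Cfg d R} {hTop : Site d → Rˣ}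
    {ε τ : ℝ} (hU₀ : ∀ x ν, UnitaryLike (U₀ x ν)) (hU₁ : ∀ x ν, UnitaryLike (U₁ x ν)) (hL : 1 ≤ L) (hε : 0 ≤ ε)
    (hdev : ∀ x ν, ‖(U₁ x ν : R) - U₀ x ν‖ ≤ ε) (hτ : ∀ z, ‖(hTop z : R) - 1‖ ≤ τ) (x : Site d) :
    ‖(multiComb (List.replicate k L) hTop U₀ U₁ x : R) - 1‖ ≤ (d : ℝ) * ((L : ℝ) ^ k - 1) * ε + τ := by
  have h := norm_multiComb_sub_one_le (List.replicate k L) hU₀ hU₁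
    (fun L' h => by rw [List.eq_of_mem_replicate h]; exact hL) hε hdev hτ x
  rw [List.prod_replicate] at h
  push_cast at h
  exact h

/-- [folklore] In particular the multilevel gauge of a pair with `U₁ = U₀` and `hTop = 1` is TRIVIAL: `g = 1` (take
`ε = τ = 0`). -/
theorem multiComb_self_eq_one [NormOneClass R] (Ls : List ℕ) (hLs : ∀ L ∈ Ls, 1 ≤ L) {U : Cfg d R}
    (hU : ∀ x ν, UnitaryLike (U x ν)) (x : Site d) : multiComb Ls (fun _ => 1) U U x = 1 := by
  have h := norm_multiComb_sub_one_le Ls (hTop := fun _ => 1) (ε := 0) (τ := 0) hU hU hLs le_rfl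
    (fun x ν => by simp) (fun z => by simp) x
  have h0 : ‖(multiComb Ls (fun _ => 1) U U x : R) - 1‖ ≤ 0 := by simpa using h
  exact Units.ext (sub_eq_zero.1 (norm_le_zero_iff.1 h0))

/-! ## §3  The factorised multilevel bounds (global hypotheses on the unitary parts, data at the bond for the factors) -/

/-- [folklore] **THE GENERIC TRANSFER, ABSOLUTE DATA**: in the multilevel comb gauge `g = multiComb Ls hTop U₀ U₁` OF THE
UNITARY PARTS (unitary-like, `unitaryLike_multiComb`), ANY bound `δ` on the unitary relative bond variable at `b` — e.g.
`multilevel_bound`, `multilevel_bound_regular(_dconst)`, `multilevel_bound_regular_local(_dconst)` of the parents — gives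
`‖pert(𝐔₀, 𝐔₁^g)(b) − 1‖ ≤ M·(n₁·δ + t₁ + t₀)` for the factorised pair, the complex factors entering ONLY at the bond `b`. -/
theorem factorised_bound_multiComb_abs [NormOneClass R] (Ls : List ℕ) {U₀ U₁ W₀ W₁ : Cfg d R}
    {hTop : Site d → Rˣ} {x : Site d} {ν : Fin d} {δ n₁ t₁ t₀ M : ℝ}
    (hU₀ : ∀ x ν, UnitaryLike (U₀ x ν)) (hU₁ : ∀ x ν, UnitaryLike (U₁ x ν)) (hh : ∀ z, UnitaryLike (hTop z))
    (hδ : ‖(pert U₀ (gaugeAct (multiComb Ls hTop U₀ U₁) U₁) x ν : R) - 1‖ ≤ δ)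
    (hn₁ : ‖(W₁ x ν : R)‖ ≤ n₁) (ht₁ : ‖(W₁ x ν : R) - 1‖ ≤ t₁) (ht₀ : ‖(W₀ x ν : R) - 1‖ ≤ t₀)
    (hM : ‖(((W₀ x ν)⁻¹ : Rˣ) : R)‖ ≤ M) :
    ‖(pert (fmul W₀ U₀) (gaugeAct (multiComb Ls hTop U₀ U₁) (fmul W₁ U₁)) x ν : R) - 1‖ ≤
      M * (n₁ * δ + t₁ + t₀) :=
  factorised_bound_gauge_abs (unitaryLike_multiComb Ls hU₀ hU₁ hh x) hδ hn₁ ht₁ ht₀ hM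

/-- [folklore] **THE GENERIC TRANSFER, RELATIVE DATA**: with `‖W₁(b) − W₀(b)‖ ≤ w` instead of `‖W₁(b) − 1‖ ≤ t₁`, and the
transport size discharged by `norm_multiComb_sub_one_le` (scales `≥ 1`, `‖U₁ − U₀‖ ≤ ε` bondwise, `‖hTop − 1‖ ≤ τ`):
`‖pert(𝐔₀, 𝐔₁^g)(b) − 1‖ ≤ M·(n₁·δ + w + 2·(d(P_k − 1)ε + τ)·t₀)` (`T4RelativeCombFactorisedPatch.factorised_bound_gauge`). -/
theorem factorised_bound_multiComb_rel [NormOneClass R] (Ls : List ℕ) {U₀ U₁ W₀ W₁ : Cfg d R}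
    {hTop : Site d → Rˣ} {x : Site d} {ν : Fin d} {δ ε τ n₁ w t₀ M : ℝ}
    (hU₀ : ∀ x ν, UnitaryLike (U₀ x ν)) (hU₁ : ∀ x ν, UnitaryLike (U₁ x ν)) (hh : ∀ z, UnitaryLike (hTop z))
    (hLs : ∀ L ∈ Ls, 1 ≤ L)
    (hδ : ‖(pert U₀ (gaugeAct (multiComb Ls hTop U₀ U₁) U₁) x ν : R) - 1‖ ≤ δ) (hε : 0 ≤ ε)
    (hdev : ∀ x ν, ‖(U₁ x ν : R) - U₀ x ν‖ ≤ ε) (hτ : ∀ z, ‖(hTop z : R) - 1‖ ≤ τ)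
    (hn₁ : ‖(W₁ x ν : R)‖ ≤ n₁) (hw : ‖(W₁ x ν : R) - W₀ x ν‖ ≤ w) (ht₀ : ‖(W₀ x ν : R) - 1‖ ≤ t₀)
    (hM : ‖(((W₀ x ν)⁻¹ : Rˣ) : R)‖ ≤ M) :
    ‖(pert (fmul W₀ U₀) (gaugeAct (multiComb Ls hTop U₀ U₁) (fmul W₁ U₁)) x ν : R) - 1‖ ≤
      M * (n₁ * δ + w + 2 * ((d : ℝ) * (((Ls.prod : ℕ) : ℝ) - 1) * ε + τ) * t₀) :=
  factorised_bound_gauge (unitaryLike_multiComb Ls hU₀ hU₁ hh x) hδ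
    (norm_multiComb_sub_one_le Ls hU₀ hU₁ hLs hε hdev hτ x) hn₁ hw ht₀ hM

/-- [folklore] `W ≡ 1` contributes nothing to a factorised configuration: `1 ⊙ U = U`. -/
theorem fmul_one_left (U : Cfg d R) : fmul (fun _ _ => (1 : Rˣ)) U = U := by
  funext y μ; exact one_mul _

/-- [folklore] **UNITARY BACKGROUND** (`W₀ = 1`: a factorised `𝐔₁ = W₁ ⊙ U₁` against a 𝔊-valued reference `U₀`): in the
multilevel comb gauge of `(U₀, U₁)`, `‖(𝐔₁^g)(b)·U₀(b)⁻¹ − 1‖ ≤ n₁·δ + t₁` — NO transport term, NO `ε`, NO `M`. -/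
theorem window_bound_multiComb [NormOneClass R] (Ls : List ℕ) {U₀ U₁ W₁ : Cfg d R} {hTop : Site d → Rˣ}
    {x : Site d} {ν : Fin d} {δ n₁ t₁ : ℝ}
    (hU₀ : ∀ x ν, UnitaryLike (U₀ x ν)) (hU₁ : ∀ x ν, UnitaryLike (U₁ x ν)) (hh : ∀ z, UnitaryLike (hTop z))
    (hδ : ‖(pert U₀ (gaugeAct (multiComb Ls hTop U₀ U₁) U₁) x ν : R) - 1‖ ≤ δ)
    (hn₁ : ‖(W₁ x ν : R)‖ ≤ n₁) (ht₁ : ‖(W₁ x ν : R) - 1‖ ≤ t₁) :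
    ‖(pert U₀ (gaugeAct (multiComb Ls hTop U₀ U₁) (fmul W₁ U₁)) x ν : R) - 1‖ ≤ n₁ * δ + t₁ := by
  have h := factorised_bound_multiComb_abs Ls (W₀ := fun _ _ => 1) (t₀ := 0) (M := 1) hU₀ hU₁ hh hδ hn₁ ht₁
    (by simp) (by simp)
  rw [fmul_one_left] at h
  linarith

/-- [folklore] … and with the one datum `‖W₁(b) − 1‖ ≤ t₁`: `≤ (1 + t₁)·δ + t₁`. -/
theorem window_bound_multiComb' [NormOneClass R] (Ls : List ℕ) {U₀ U₁ W₁ : Cfg d R} {hTop : Site d → Rˣ}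
    {x : Site d} {ν : Fin d} {δ t₁ : ℝ}
    (hU₀ : ∀ x ν, UnitaryLike (U₀ x ν)) (hU₁ : ∀ x ν, UnitaryLike (U₁ x ν)) (hh : ∀ z, UnitaryLike (hTop z))
    (hδ : ‖(pert U₀ (gaugeAct (multiComb Ls hTop U₀ U₁) U₁) x ν : R) - 1‖ ≤ δ)
    (ht₁ : ‖(W₁ x ν : R) - 1‖ ≤ t₁) :
    ‖(pert U₀ (gaugeAct (multiComb Ls hTop U₀ U₁) (fmul W₁ U₁)) x ν : R) - 1‖ ≤ (1 + t₁) * δ + t₁ :=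
  window_bound_multiComb Ls hU₀ hU₁ hh hδ (norm_le_one_add_of_norm_sub_one_le ht₁) ht₁

/-- [folklore] **THE FACTORISED `k`-UNIFORM MULTILEVEL BOUND, ABSOLUTE DATA** (`L ≥ 2`, uniform scale list): unitary-like
parts with (52)-format regularity `FineRegular L k aᵢ Uᵢ`, a unitary-like top gauge, `X` bounding the top relative
deviation, complex factors with `‖W₁(b)‖ ≤ n₁`, `‖W₁(b) − 1‖ ≤ t₁`, `‖W₀(b) − 1‖ ≤ t₀`, `‖W₀(b)⁻¹‖ ≤ M` AT THE BOND `b`: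
`‖pert(𝐔₀, 𝐔₁^g)(b) − 1‖ ≤ M·(n₁·((d−1)(2d−1)·(a₁ + a₀) + X) + t₁ + t₀)` — independent of `k` and of `L`
(`T4MultilevelCombRegular.multilevel_bound_regular_dconst` BY NAME as `δ`). -/
theorem factorised_multilevel_bound_regular_abs [NormOneClass R] {L : ℕ} (k : ℕ) {U₀ U₁ W₀ W₁ : Cfg d R}
    {hTop : Site d → Rˣ} {a₁ a₀ X n₁ t₁ t₀ M : ℝ} (hU₀ : ∀ x ν, UnitaryLike (U₀ x ν))
    (hU₁ : ∀ x ν, UnitaryLike (U₁ x ν)) (hh : ∀ z, UnitaryLike (hTop z)) (hL : 2 ≤ L)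
    (ha₁ : FineRegular L k a₁ U₁) (ha₀ : FineRegular L k a₀ U₀)
    (hX : ∀ z ν, ‖(pert (scaled (L ^ k) U₀) (gaugeAct hTop (scaled (L ^ k) U₁)) z ν : R) - 1‖ ≤ X)
    (x : Site d) (ν : Fin d) (hn₁ : ‖(W₁ x ν : R)‖ ≤ n₁) (ht₁ : ‖(W₁ x ν : R) - 1‖ ≤ t₁)
    (ht₀ : ‖(W₀ x ν : R) - 1‖ ≤ t₀) (hM : ‖(((W₀ x ν)⁻¹ : Rˣ) : R)‖ ≤ M) :
    ‖(pert (fmul W₀ U₀) (gaugeAct (multiComb (List.replicate k L) hTop U₀ U₁) (fmul W₁ U₁)) x ν : R) - 1‖ ≤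
      M * (n₁ * (((d : ℝ) - 1) * (2 * (d : ℝ) - 1) * (a₁ + a₀) + X) + t₁ + t₀) :=
  factorised_bound_multiComb_abs _ hU₀ hU₁ hh (multilevel_bound_regular_dconst k hU₀ hU₁ hh hL ha₁ ha₀ hX x ν)
    hn₁ ht₁ ht₀ hM

/-- [folklore] **THE FACTORISED `k`-UNIFORM MULTILEVEL BOUND, RELATIVE DATA** (`L ≥ 2`): as above with
`‖W₁(b) − W₀(b)‖ ≤ w`, `‖U₁ − U₀‖ ≤ ε` bondwise (`ε ≥ 0`), `‖hTop − 1‖ ≤ τ`: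
`≤ M·(n₁·((d−1)(2d−1)·(a₁ + a₀) + X) + w + 2·(d(L^k − 1)ε + τ)·t₀)` — the transport term grows LINEARLY with the side
`L^k` of the top block. -/
theorem factorised_multilevel_bound_regular_rel [NormOneClass R] {L : ℕ} (k : ℕ) {U₀ U₁ W₀ W₁ : Cfg d R}
    {hTop : Site d → Rˣ} {a₁ a₀ X ε τ n₁ w t₀ M : ℝ} (hU₀ : ∀ x ν, UnitaryLike (U₀ x ν))
    (hU₁ : ∀ x ν, UnitaryLike (U₁ x ν)) (hh : ∀ z, UnitaryLike (hTop z)) (hL : 2 ≤ L)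
    (ha₁ : FineRegular L k a₁ U₁) (ha₀ : FineRegular L k a₀ U₀)
    (hX : ∀ z ν, ‖(pert (scaled (L ^ k) U₀) (gaugeAct hTop (scaled (L ^ k) U₁)) z ν : R) - 1‖ ≤ X)
    (hε : 0 ≤ ε) (hdev : ∀ x ν, ‖(U₁ x ν : R) - U₀ x ν‖ ≤ ε) (hτ : ∀ z, ‖(hTop z : R) - 1‖ ≤ τ)
    (x : Site d) (ν : Fin d) (hn₁ : ‖(W₁ x ν : R)‖ ≤ n₁) (hw : ‖(W₁ x ν : R) - W₀ x ν‖ ≤ w)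
    (ht₀ : ‖(W₀ x ν : R) - 1‖ ≤ t₀) (hM : ‖(((W₀ x ν)⁻¹ : Rˣ) : R)‖ ≤ M) :
    ‖(pert (fmul W₀ U₀) (gaugeAct (multiComb (List.replicate k L) hTop U₀ U₁) (fmul W₁ U₁)) x ν : R) - 1‖ ≤
      M * (n₁ * (((d : ℝ) - 1) * (2 * (d : ℝ) - 1) * (a₁ + a₀) + X) + w
        + 2 * ((d : ℝ) * ((L : ℝ) ^ k - 1) * ε + τ) * t₀) :=
  factorised_bound_gauge (unitaryLike_multiComb _ hU₀ hU₁ hh x)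
    (multilevel_bound_regular_dconst k hU₀ hU₁ hh hL ha₁ ha₀ hX x ν)
    (norm_multiComb_replicate_sub_one_le L k hU₀ hU₁ (by omega) hε hdev hτ x) hn₁ hw ht₀ hM

/-- [folklore] **THE WINDOW FORM** (unitary background `U₀`, `L ≥ 2`): a factorised `𝐔₁ = W₁ ⊙ U₁` with `U₁`, `U₀`
`FineRegular`, in the multilevel comb gauge of `(U₀, U₁)`: `‖(𝐔₁^g)(b)·U₀(b)⁻¹ − 1‖ ≤ n₁·((d−1)(2d−1)·(a₁ + a₀) + X) + t₁`
on EVERY bond — for every number of levels `k`, every `L ≥ 2`, with NO transport-size and NO `ε` hypothesis. -/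
theorem window_multilevel_bound_regular [NormOneClass R] {L : ℕ} (k : ℕ) {U₀ U₁ W₁ : Cfg d R}
    {hTop : Site d → Rˣ} {a₁ a₀ X n₁ t₁ : ℝ} (hU₀ : ∀ x ν, UnitaryLike (U₀ x ν))
    (hU₁ : ∀ x ν, UnitaryLike (U₁ x ν)) (hh : ∀ z, UnitaryLike (hTop z)) (hL : 2 ≤ L)
    (ha₁ : FineRegular L k a₁ U₁) (ha₀ : FineRegular L k a₀ U₀)
    (hX : ∀ z ν, ‖(pert (scaled (L ^ k) U₀) (gaugeAct hTop (scaled (L ^ k) U₁)) z ν : R) - 1‖ ≤ X)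
    (x : Site d) (ν : Fin d) (hn₁ : ‖(W₁ x ν : R)‖ ≤ n₁) (ht₁ : ‖(W₁ x ν : R) - 1‖ ≤ t₁) :
    ‖(pert U₀ (gaugeAct (multiComb (List.replicate k L) hTop U₀ U₁) (fmul W₁ U₁)) x ν : R) - 1‖ ≤
      n₁ * (((d : ℝ) - 1) * (2 * (d : ℝ) - 1) * (a₁ + a₀) + X) + t₁ :=
  window_bound_multiComb _ hU₀ hU₁ hh (multilevel_bound_regular_dconst k hU₀ hU₁ hh hL ha₁ ha₀ hX x ν) hn₁ ht₁

/-! ## §4  The LOCAL forms: curvatures on the two top blocks over the bond, the one top bond, the factors at the bond -/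

/-- [folklore] **THE FACTORISED `k`-UNIFORM BOUND, LOCAL FORM, ABSOLUTE DATA** (`L ≥ 2`): hypotheses = (52)-format
regularity `aᵢ·L^{−2k}` of the unitary parts on the fine plaquettes of the two top blocks over `b = ⟨x, x + e_ν⟩`
(`FineRegularOn`), `a₁ + a₀ ≥ 0`, a unitary-like top gauge, and the complex factors AT THE BOND `b`; conclusion
`‖pert(𝐔₀, 𝐔₁^g)(b) − 1‖ ≤ M·(n₁·((d−1)(2d−1)·(a₁ + a₀) + ‖top-bond relative deviation‖) + t₁ + t₀)`
(`T4MultilevelCombLocal.multilevel_bound_regular_local_dconst` BY NAME as `δ`). -/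
theorem factorised_multilevel_bound_local_abs [NormOneClass R] {L : ℕ} (k : ℕ) {U₀ U₁ W₀ W₁ : Cfg d R}
    {hTop : Site d → Rˣ} {a₁ a₀ n₁ t₁ t₀ M : ℝ} (hU₀ : ∀ x ν, UnitaryLike (U₀ x ν))
    (hU₁ : ∀ x ν, UnitaryLike (U₁ x ν)) (hh : ∀ z, UnitaryLike (hTop z)) (hL : 2 ≤ L) (x : Site d) (ν : Fin d)
    (ha₁ : FineRegularOn L k a₁ U₁ x ν) (ha₀ : FineRegularOn L k a₀ U₀ x ν) (ha : 0 ≤ a₁ + a₀)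
    (hn₁ : ‖(W₁ x ν : R)‖ ≤ n₁) (ht₁ : ‖(W₁ x ν : R) - 1‖ ≤ t₁) (ht₀ : ‖(W₀ x ν : R) - 1‖ ≤ t₀)
    (hM : ‖(((W₀ x ν)⁻¹ : Rˣ) : R)‖ ≤ M) :
    ‖(pert (fmul W₀ U₀) (gaugeAct (multiComb (List.replicate k L) hTop U₀ U₁) (fmul W₁ U₁)) x ν : R) - 1‖ ≤
      M * (n₁ * (((d : ℝ) - 1) * (2 * (d : ℝ) - 1) * (a₁ + a₀) +
        ‖(pert (scaled (L ^ k) U₀) (gaugeAct hTop (scaled (L ^ k) U₁)) (blockIndex (L ^ k) x) ν : R) - 1‖)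
        + t₁ + t₀) :=
  factorised_bound_multiComb_abs _ hU₀ hU₁ hh
    (multilevel_bound_regular_local_dconst k hU₀ hU₁ hh hL x ν ha₁ ha₀ ha) hn₁ ht₁ ht₀ hM

/-- [folklore] **LOCAL FORM, RELATIVE DATA, FREE TRANSPORT SIZE**: with `‖W₁(b) − W₀(b)‖ ≤ w` and a bound `γ` on the
transport size `‖g_x − 1‖` AT THE SITE `x` as a free input (globally `γ = d(L^k − 1)ε + τ` by
`norm_multiComb_replicate_sub_one_le`; `γ ≤ 2` always, `T4RelativeCombWindow.norm_sub_one_le_two_of_unitaryLike`):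
`≤ M·(n₁·((d−1)(2d−1)·(a₁ + a₀) + ‖top bond‖) + w + 2·γ·t₀)`. -/
theorem factorised_multilevel_bound_local_rel [NormOneClass R] {L : ℕ} (k : ℕ) {U₀ U₁ W₀ W₁ : Cfg d R}
    {hTop : Site d → Rˣ} {a₁ a₀ γ n₁ w t₀ M : ℝ} (hU₀ : ∀ x ν, UnitaryLike (U₀ x ν))
    (hU₁ : ∀ x ν, UnitaryLike (U₁ x ν)) (hh : ∀ z, UnitaryLike (hTop z)) (hL : 2 ≤ L) (x : Site d) (ν : Fin d)
    (ha₁ : FineRegularOn L k a₁ U₁ x ν) (ha₀ : FineRegularOn L k a₀ U₀ x ν) (ha : 0 ≤ a₁ + a₀)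
    (hγ : ‖(multiComb (List.replicate k L) hTop U₀ U₁ x : R) - 1‖ ≤ γ)
    (hn₁ : ‖(W₁ x ν : R)‖ ≤ n₁) (hw : ‖(W₁ x ν : R) - W₀ x ν‖ ≤ w) (ht₀ : ‖(W₀ x ν : R) - 1‖ ≤ t₀)
    (hM : ‖(((W₀ x ν)⁻¹ : Rˣ) : R)‖ ≤ M) :
    ‖(pert (fmul W₀ U₀) (gaugeAct (multiComb (List.replicate k L) hTop U₀ U₁) (fmul W₁ U₁)) x ν : R) - 1‖ ≤
      M * (n₁ * (((d : ℝ) - 1) * (2 * (d : ℝ) - 1) * (a₁ + a₀) +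
        ‖(pert (scaled (L ^ k) U₀) (gaugeAct hTop (scaled (L ^ k) U₁)) (blockIndex (L ^ k) x) ν : R) - 1‖)
        + w + 2 * γ * t₀) :=
  factorised_bound_gauge (unitaryLike_multiComb _ hU₀ hU₁ hh x)
    (multilevel_bound_regular_local_dconst k hU₀ hU₁ hh hL x ν ha₁ ha₀ ha) hγ hn₁ hw ht₀ hM

/-- [folklore] **THE WINDOW FORM, LOCAL** (unitary background): `‖(𝐔₁^g)(b)·U₀(b)⁻¹ − 1‖ ≤
n₁·((d−1)(2d−1)·(a₁ + a₀) + ‖top-bond relative deviation‖) + t₁`, every hypothesis living over the bond `b`. -/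
theorem window_multilevel_bound_local [NormOneClass R] {L : ℕ} (k : ℕ) {U₀ U₁ W₁ : Cfg d R}
    {hTop : Site d → Rˣ} {a₁ a₀ n₁ t₁ : ℝ} (hU₀ : ∀ x ν, UnitaryLike (U₀ x ν)) (hU₁ : ∀ x ν, UnitaryLike (U₁ x ν))
    (hh : ∀ z, UnitaryLike (hTop z)) (hL : 2 ≤ L) (x : Site d) (ν : Fin d) (ha₁ : FineRegularOn L k a₁ U₁ x ν)
    (ha₀ : FineRegularOn L k a₀ U₀ x ν) (ha : 0 ≤ a₁ + a₀) (hn₁ : ‖(W₁ x ν : R)‖ ≤ n₁)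
    (ht₁ : ‖(W₁ x ν : R) - 1‖ ≤ t₁) :
    ‖(pert U₀ (gaugeAct (multiComb (List.replicate k L) hTop U₀ U₁) (fmul W₁ U₁)) x ν : R) - 1‖ ≤
      n₁ * (((d : ℝ) - 1) * (2 * (d : ℝ) - 1) * (a₁ + a₀) +
        ‖(pert (scaled (L ^ k) U₀) (gaugeAct hTop (scaled (L ^ k) U₁)) (blockIndex (L ^ k) x) ν : R) - 1‖) + t₁ :=
  window_bound_multiComb _ hU₀ hU₁ hh (multilevel_bound_regular_local_dconst k hU₀ hU₁ hh hL x ν ha₁ ha₀ ha) hn₁ ht₁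

/-- [folklore] **THE WINDOW FORM, LOCAL, SAME TOP BOND**: if moreover the top pair agrees on the one top bond over `b` in
the gauge `hTop`, then `‖(𝐔₁^g)(b)·U₀(b)⁻¹ − 1‖ ≤ n₁·(d−1)(2d−1)·(a₁ + a₀) + t₁`. -/
theorem window_same_top_bond_bound [NormOneClass R] {L : ℕ} (k : ℕ) {U₀ U₁ W₁ : Cfg d R}
    {hTop : Site d → Rˣ} {a₁ a₀ n₁ t₁ : ℝ} (hU₀ : ∀ x ν, UnitaryLike (U₀ x ν)) (hU₁ : ∀ x ν, UnitaryLike (U₁ x ν))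
    (hh : ∀ z, UnitaryLike (hTop z)) (hL : 2 ≤ L) (x : Site d) (ν : Fin d) (ha₁ : FineRegularOn L k a₁ U₁ x ν)
    (ha₀ : FineRegularOn L k a₀ U₀ x ν) (ha : 0 ≤ a₁ + a₀) (hn₁ : ‖(W₁ x ν : R)‖ ≤ n₁)
    (ht₁ : ‖(W₁ x ν : R) - 1‖ ≤ t₁)
    (htop : gaugeAct hTop (scaled (L ^ k) U₁) (blockIndex (L ^ k) x) ν = scaled (L ^ k) U₀ (blockIndex (L ^ k) x) ν) :
    ‖(pert U₀ (gaugeAct (multiComb (List.replicate k L) hTop U₀ U₁) (fmul W₁ U₁)) x ν : R) - 1‖ ≤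
      n₁ * (((d : ℝ) - 1) * (2 * (d : ℝ) - 1) * (a₁ + a₀)) + t₁ := by
  have h := window_multilevel_bound_local k hU₀ hU₁ hh hL x ν ha₁ ha₀ ha hn₁ ht₁
  have h0 : ‖(pert (scaled (L ^ k) U₀) (gaugeAct hTop (scaled (L ^ k) U₁)) (blockIndex (L ^ k) x) ν : R) - 1‖ = 0 := by
    rw [norm_eq_zero, sub_eq_zero, pert, htop, mul_inv_cancel, Units.val_one]
  rw [h0, add_zero] at h
  exact h

/-! ## §5  Consistency, non-vacuity, sharpness -/

/-- [folklore] CONSISTENCY: trivial complex factors `W₀ = W₁ = 1` (`n₁ = 1`, `t₁ = t₀ = 0`, `M = 1`) return exactly the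
unitary bound `δ`. -/
theorem factorised_bound_multiComb_abs_one [NormOneClass R] (Ls : List ℕ) {U₀ U₁ : Cfg d R} {hTop : Site d → Rˣ}
    {x : Site d} {ν : Fin d} {δ : ℝ} (hU₀ : ∀ x ν, UnitaryLike (U₀ x ν)) (hU₁ : ∀ x ν, UnitaryLike (U₁ x ν))
    (hh : ∀ z, UnitaryLike (hTop z)) (hδ : ‖(pert U₀ (gaugeAct (multiComb Ls hTop U₀ U₁) U₁) x ν : R) - 1‖ ≤ δ) :
    ‖(pert (fmul (fun _ _ => 1) U₀) (gaugeAct (multiComb Ls hTop U₀ U₁) (fmul (fun _ _ => 1) U₁)) x ν : R) - 1‖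
      ≤ δ := by
  have h := factorised_bound_multiComb_abs Ls (W₀ := fun _ _ => 1) (W₁ := fun _ _ => 1) (n₁ := 1) (t₁ := 0)
    (t₀ := 0) (M := 1) hU₀ hU₁ hh hδ (by simp) (by simp) (by simp) (by simp)
  linarith

/-- [folklore] The flat configuration is `FineRegular L k 0`. -/
theorem fineRegular_flat [NormOneClass R] (L k : ℕ) : FineRegular L k 0 (fun _ _ => (1 : Rˣ) : Cfg d R) := by
  intro x ρ κ _; simp [plaq]

/-- [folklore] The straight transports of the flat configuration are flat (`T4MultilevelCombGauge.hol_line_eq_one`). -/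
theorem scaled_flat (N : ℕ) : scaled N (fun _ _ => (1 : Rˣ)) = (fun _ _ => (1 : Rˣ) : Cfg d R) := by
  funext y μ; exact hol_line_eq_one N (fun _ _ => rfl)

/-- [folklore] NON-VACUITY AND SHARPNESS OF THE COEFFICIENT OF `t₁`: for the flat unitary pair `U₀ = U₁ = 1` (regular
with `a₁ = a₀ = 0`, top deviation `X = 0` in the trivial top gauge) and a CONSTANT complex factor `W₁ ≡ c`, the
multilevel gauge is `1` (`multiComb_self_eq_one`), the left-hand side of `window_multilevel_bound_regular` IS `‖c − 1‖`,
and the right-hand side with `n₁ = ‖c‖`, `t₁ = ‖c − 1‖` is `‖c‖·0 + ‖c − 1‖`: the bound is ATTAINED. -/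
theorem window_bound_flat_attained [NormOneClass R] {L : ℕ} (hL : 2 ≤ L) (k : ℕ) (c : Rˣ) (x : Site d) (ν : Fin d) :
    ‖(pert (fun _ _ => (1 : Rˣ)) (gaugeAct (multiComb (List.replicate k L) (fun _ => 1) (fun _ _ => 1) (fun _ _ => 1))
        (fmul (fun _ _ => c) (fun _ _ => (1 : Rˣ)))) x ν : R) - 1‖ = ‖(c : R) - 1‖ ∧
    ‖(pert (fun _ _ => (1 : Rˣ)) (gaugeAct (multiComb (List.replicate k L) (fun _ => 1) (fun _ _ => 1) (fun _ _ => 1))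
        (fmul (fun _ _ => c) (fun _ _ => (1 : Rˣ)))) x ν : R) - 1‖ ≤
      ‖(c : R)‖ * (((d : ℝ) - 1) * (2 * (d : ℝ) - 1) * (0 + 0) + 0) + ‖(c : R) - 1‖ := by
  have h1 : ∀ (x : Site d) (ν : Fin d), UnitaryLike ((fun _ _ => (1 : Rˣ)) x ν) := fun _ _ => UnitaryLike.one
  have hg : ∀ y : Site d, multiComb (List.replicate k L) (fun _ => 1) (fun _ _ => (1 : Rˣ)) (fun _ _ => (1 : Rˣ)) y
      = 1 :=
    fun y => multiComb_self_eq_one (List.replicate k L)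
      (fun L' h => by rw [List.eq_of_mem_replicate h]; omega) h1 y
  refine ⟨?_, ?_⟩
  · simp only [pert, gaugeAct, fmul, hg]
    simp
  · refine window_multilevel_bound_regular k h1 h1 (fun _ => UnitaryLike.one) hL (fineRegular_flat L k)
      (fineRegular_flat L k) ?_ x ν le_rfl le_rfl
    intro z μ
    rw [scaled_flat]
    simp [pert, gaugeAct]

/-- [folklore] SHARPNESS OF THE COEFFICIENT OF `t₀`: for the flat unitary pair, trivial `W₁ = 1` and a CONSTANT complex
BACKGROUND factor `W₀ ≡ c`, the left-hand side of `factorised_multilevel_bound_regular_abs` IS `‖c⁻¹ − 1‖` and its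
right-hand side with `n₁ = 1`, `t₁ = 0`, `t₀ = ‖c − 1‖`, `M = ‖c⁻¹‖` is `‖c⁻¹‖·‖c − 1‖` — attained whenever
`‖c⁻¹(1 − c)‖ = ‖c⁻¹‖·‖1 − c‖` (e.g. scalar `c`): the background's complex factor is paid ONCE, whatever `k` and `L`. -/
theorem abs_bound_flat_background [NormOneClass R] {L : ℕ} (hL : 2 ≤ L) (k : ℕ) (c : Rˣ) (x : Site d) (ν : Fin d) :
    ‖(pert (fmul (fun _ _ => c) (fun _ _ => (1 : Rˣ)))
        (gaugeAct (multiComb (List.replicate k L) (fun _ => 1) (fun _ _ => 1) (fun _ _ => 1))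
          (fmul (fun _ _ => (1 : Rˣ)) (fun _ _ => (1 : Rˣ)))) x ν : R) - 1‖ = ‖((c⁻¹ : Rˣ) : R) - 1‖ ∧
    ‖(pert (fmul (fun _ _ => c) (fun _ _ => (1 : Rˣ)))
        (gaugeAct (multiComb (List.replicate k L) (fun _ => 1) (fun _ _ => 1) (fun _ _ => 1))
          (fmul (fun _ _ => (1 : Rˣ)) (fun _ _ => (1 : Rˣ)))) x ν : R) - 1‖ ≤
      ‖((c⁻¹ : Rˣ) : R)‖ * (1 * (((d : ℝ) - 1) * (2 * (d : ℝ) - 1) * (0 + 0) + 0) + 0 + ‖(c : R) - 1‖) := by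
  have h1 : ∀ (x : Site d) (ν : Fin d), UnitaryLike ((fun _ _ => (1 : Rˣ)) x ν) := fun _ _ => UnitaryLike.one
  have hg : ∀ y : Site d, multiComb (List.replicate k L) (fun _ => 1) (fun _ _ => (1 : Rˣ)) (fun _ _ => (1 : Rˣ)) y
      = 1 :=
    fun y => multiComb_self_eq_one (List.replicate k L)
      (fun L' h => by rw [List.eq_of_mem_replicate h]; omega) h1 y
  refine ⟨?_, ?_⟩
  · simp only [pert, gaugeAct, fmul, hg]
    simp
  · refine factorised_multilevel_bound_regular_abs k h1 h1 (fun _ => UnitaryLike.one) hL (fineRegular_flat L k)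
      (fineRegular_flat L k) ?_ x ν (by simp) (by simp) le_rfl le_rfl
    intro z μ
    rw [scaled_flat]
    simp [pert, gaugeAct]

/-- The constant in `d = 4`: `(d−1)(2d−1) = 21`; the window form then reads `≤ n₁·(21·(a₁ + a₀) + X) + t₁`. -/
example : ((4 : ℝ) - 1) * (2 * (4 : ℝ) - 1) = 21 := by norm_num

/-- The telescoping identity behind §2 for three scales `2, 3, 5`: `d·(2−1) + 2·(d·(3−1) + 3·(d·(5−1))) = d·(30 − 1)`. -/
example (d : ℝ) : d * (2 - 1) + 2 * (d * (3 - 1) + 3 * (d * (5 - 1))) = d * (30 - 1) := by ring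

/-- Non-vacuity of the transport-size bound: the trivial gauge of the flat pair has size `0 ≤ d·(L^k − 1)·0 + 0`. -/
example [NormOneClass R] {L : ℕ} (hL : 1 ≤ L) (k : ℕ) (x : Site d) :
    ‖(multiComb (List.replicate k L) (fun _ => 1) (fun _ _ => (1 : Rˣ)) (fun _ _ => (1 : Rˣ)) x : R) - 1‖ ≤
      (d : ℝ) * ((L : ℝ) ^ k - 1) * 0 + 0 :=
  norm_multiComb_replicate_sub_one_le L k (fun _ _ => UnitaryLike.one) (fun _ _ => UnitaryLike.one) hL le_rfl
    (fun _ _ => by simp) (fun _ => by simp) x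

/-! ## §6  ONE-BLOCK CONSUMER FORMS (v1.1, APPEND-ONLY): γ-free drop-in replacements, in the EXACT statement formats of
`T4RelativeCombWindow.factorised_interior_bound_crude` / `_fine` and of the consumer `T4BlockTransport.factorised_bond_bound`

The one-block relative comb gauge `g = combGauge U₀ U₁ z` OF THE UNITARY PARTS (`T4RelativeComb`; unitary-like,
`unitaryLike_combGauge`) is a special case of §1's "any gauge field unitary-like at `x`", and `T4RelativeComb.defect U₀ U₁ z x ν`
IS `pert U₀ (U₁^g) x ν` (both unfold to `(U₁^g)(b)·U₀(b)⁻¹`).  So §1 gives, for the factorised pair `𝐔ᵢ = Wᵢ ⊙ Uᵢ` and in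
the left-hand-side format `‖((𝐔₁^g)(b)·𝐔₀(b)⁻¹ : Rˣ) − 1‖` of `T4RelativeCombWindow` §7:
* ABSOLUTE window data (`‖W₁(b)‖ ≤ n₁`, `‖W₁(b) − 1‖ ≤ t₁`, `‖W₀(b) − 1‖ ≤ t₀`, `‖W₀(b)⁻¹‖ ≤ M`):  `M·(n₁·δ + t₁ + t₀)`
  (`factorised_defect_bound_abs`), with `δ` the crude (`interior_bound_crude`: `(d−1)(L−1)(q₁+q₀)`) or the fine
  (`interior_bound_fine`) unitary interior bound — `factorised_interior_bound_crude_abs`, `factorised_interior_bound_fine_abs`;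
* the UNCHANGED RELATIVE data of `T4RelativeCombWindow.factorised_interior_bound_crude` / `_fine` (`‖W₁(b) − W₀(b)‖ ≤ w`
  in place of `t₁`; since `‖W₁(b) − 1‖ ≤ w + t₀`):  `M·(n₁·δ + w + 2·t₀)` — `factorised_defect_bound_two`,
  `factorised_interior_bound_crude_two` (vs. Window-crude's `… + w + 4·t₀`: the crude transport size `‖g − 1‖ ≤ 2` is gone),
  `factorised_interior_bound_fine_two` (vs. Window-fine's `… + w + 2·(d(L−1)ε)·t₀`: better iff the comb transport size bound
  `d(L−1)ε` exceeds `1`, worse otherwise — HONEST: with relative data and SMALL transport the fine form of Window keeps the edge;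
  the point of the `γ`-free forms is independence of `L` (and, §3–§4, of the number of levels));
* the BOND-DEVIATION format `‖(𝐔₁^g)(b) − 𝐔₀(b)‖ ≤ n₀·(…)` (`‖W₀(b)‖ ≤ n₀`) that `T4BlockTransport.block_transport` consumes
  through its hypothesis `hCδ`: `factorised_bond_deviation_abs` and `factorised_bond_deviation_two` — the latter with the SAME
  hypothesis list, in the SAME order, as `T4BlockTransport.factorised_bond_bound`, and the constant
  `n₀·M·(n₁·(d−1)(L−1)(q₁+q₀) + wd + 2·t₀)` in place of its `… + wd + 4·t₀` (that file belongs to the t4-ne1p-p1 lineage and is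
  not touched here; a consumer tightens `block_transport_factorised` / `relGauge_factorised` by swapping one name).
[folklore] bookkeeping over §1 and the parents BY NAME; no estimate; nothing printed asserted. -/

section OneBlock

open T4RelativeComb (combGauge defect PlaqSup unitaryLike_combGauge interior_bound_crude interior_bound_fine)

/-- [folklore] `‖V(b) − U(b)‖ ≤ ‖pert(U, V)(b) − 1‖·‖U(b)‖` (`V − U = (V·U⁻¹ − 1)·U`). -/
theorem norm_sub_le_norm_pert_sub_one_mul (U V : Cfg d R) (x : Site d) (ν : Fin d) :
    ‖(V x ν : R) - U x ν‖ ≤ ‖(pert U V x ν : R) - 1‖ * ‖(U x ν : R)‖ := by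
  have e1 : (V x ν : R) - U x ν = ((pert U V x ν : R) - 1) * (U x ν : R) := by
    rw [pert, sub_mul, one_mul, Units.val_mul, Units.inv_mul_cancel_right]
  rw [e1]
  exact norm_mul_le _ _

/-- [folklore] Bond-deviation form of a `pert` bound: `‖pert(U, V)(b) − 1‖ ≤ C` and `‖U(b)‖ ≤ n₀` give
`‖V(b) − U(b)‖ ≤ n₀·C`. -/
theorem norm_sub_le_of_pert_bound {U V : Cfg d R} {x : Site d} {ν : Fin d} {C n₀ : ℝ}
    (hC : ‖(pert U V x ν : R) - 1‖ ≤ C) (hn₀ : ‖(U x ν : R)‖ ≤ n₀) : ‖(V x ν : R) - U x ν‖ ≤ n₀ * C := by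
  calc _ ≤ ‖(pert U V x ν : R) - 1‖ * ‖(U x ν : R)‖ := norm_sub_le_norm_pert_sub_one_mul U V x ν
    _ ≤ C * n₀ := mul_le_mul hC hn₀ (norm_nonneg _) ((norm_nonneg _).trans hC)
    _ = n₀ * C := mul_comm _ _

/-- [folklore] `‖(W ⊙ U)(b)‖ ≤ ‖W(b)‖` for unitary-like `U(b)`. -/
theorem norm_fmul_le [NormOneClass R] {U : Cfg d R} (W : Cfg d R) {x : Site d} {ν : Fin d} (hU : UnitaryLike (U x ν)) :
    ‖(fmul W U x ν : R)‖ ≤ ‖(W x ν : R)‖ := by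
  rw [T4RelativeCombWindow.fmul_apply, Units.val_mul]
  calc _ ≤ ‖(W x ν : R)‖ * ‖(U x ν : R)‖ := norm_mul_le _ _
    _ ≤ ‖(W x ν : R)‖ * 1 := mul_le_mul_of_nonneg_left hU.1 (norm_nonneg _)
    _ = _ := mul_one _

/-- [folklore] The comb gauge of a pair with EQUAL unitary parts is trivial: `combGauge U U z x = 1`. -/
theorem combGauge_self (U : Cfg d R) (z x : Site d) : combGauge U U z x = 1 := by
  simp [T4RelativeComb.combGauge, T4RelativeComb.relGauge]

/-- [folklore] **ONE-BLOCK FACTORISED RESPONSE, ABSOLUTE DATA** (pointwise; the `δ`-abstract form): in the relative comb gauge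
`g = combGauge U₀ U₁ z` of the unitary parts, `‖defect(U₀, U₁)(b) − 1‖ ≤ δ` and the absolute window data at `b` give
`‖(𝐔₁^g)(b)·𝐔₀(b)⁻¹ − 1‖ ≤ M·(n₁·δ + t₁ + t₀)` — NO transport-size hypothesis (compare `T4RelativeCombWindow.factorised_bound`:
`M·(n₁·δ + w + 2γ·t₀)` with `‖g_x − 1‖ ≤ γ`). -/
theorem factorised_defect_bound_abs [NormOneClass R] {U₀ U₁ W₀ W₁ : Cfg d R} {z x : Site d} {ν : Fin d}
    {δ n₁ t₁ t₀ M : ℝ} (hU₀ : ∀ x ν, UnitaryLike (U₀ x ν)) (hU₁ : ∀ x ν, UnitaryLike (U₁ x ν))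
    (hδ : ‖(defect U₀ U₁ z x ν : R) - 1‖ ≤ δ)
    (hn₁ : ‖(W₁ x ν : R)‖ ≤ n₁) (ht₁ : ‖(W₁ x ν : R) - 1‖ ≤ t₁) (ht₀ : ‖(W₀ x ν : R) - 1‖ ≤ t₀)
    (hM : ‖(((W₀ x ν)⁻¹ : Rˣ) : R)‖ ≤ M) :
    ‖((gaugeAct (combGauge U₀ U₁ z) (fmul W₁ U₁) x ν * (fmul W₀ U₀ x ν)⁻¹ : Rˣ) : R) - 1‖ ≤ M * (n₁ * δ + t₁ + t₀) := by
  have hδ' : ‖(pert U₀ (gaugeAct (combGauge U₀ U₁ z) U₁) x ν : R) - 1‖ ≤ δ := hδ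
  exact factorised_bound_gauge_abs (unitaryLike_combGauge hU₀ hU₁ z x) hδ' hn₁ ht₁ ht₀ hM

/-- [folklore] **ONE-BLOCK FACTORISED RESPONSE, RELATIVE DATA, γ-FREE** (pointwise): the hypotheses of
`T4RelativeCombWindow.factorised_bound` WITHOUT `hγ`, conclusion `M·(n₁·δ + w + 2·t₀)` (`‖W₁(b) − 1‖ ≤ w + t₀`). -/
theorem factorised_defect_bound_two [NormOneClass R] {U₀ U₁ W₀ W₁ : Cfg d R} {z x : Site d} {ν : Fin d}
    {δ n₁ w t₀ M : ℝ} (hU₀ : ∀ x ν, UnitaryLike (U₀ x ν)) (hU₁ : ∀ x ν, UnitaryLike (U₁ x ν))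
    (hδ : ‖(defect U₀ U₁ z x ν : R) - 1‖ ≤ δ)
    (hn₁ : ‖(W₁ x ν : R)‖ ≤ n₁) (hw : ‖(W₁ x ν : R) - W₀ x ν‖ ≤ w) (ht₀ : ‖(W₀ x ν : R) - 1‖ ≤ t₀)
    (hM : ‖(((W₀ x ν)⁻¹ : Rˣ) : R)‖ ≤ M) :
    ‖((gaugeAct (combGauge U₀ U₁ z) (fmul W₁ U₁) x ν * (fmul W₀ U₀ x ν)⁻¹ : Rˣ) : R) - 1‖ ≤ M * (n₁ * δ + w + 2 * t₀) := by
  have ht₁ : ‖(W₁ x ν : R) - 1‖ ≤ w + t₀ := (norm_sub_le_norm_sub_add_norm_sub _ _ _).trans (add_le_add hw ht₀)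
  have h := factorised_defect_bound_abs hU₀ hU₁ hδ hn₁ ht₁ ht₀ hM
  have e : M * (n₁ * δ + (w + t₀) + t₀) = M * (n₁ * δ + w + 2 * t₀) := by ring
  rwa [e] at h

/-- [folklore] BLOCK FORM, CRUDE UNITARY INPUT, ABSOLUTE DATA: curvatures `≤ q₁`, `≤ q₀` of the unitary parts on `B(z)` and
absolute window data on the block give on interior bonds `‖(𝐔₁^g)(b)·𝐔₀(b)⁻¹ − 1‖ ≤ M·(n₁·(d−1)(L−1)(q₁+q₀) + t₁ + t₀)`. -/
theorem factorised_interior_bound_crude_abs [NormOneClass R] {U₀ U₁ W₀ W₁ : Cfg d R} {z : Site d} {L : ℕ}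
    {q₀ q₁ n₁ t₁ t₀ M : ℝ} (hU₀ : ∀ x ν, UnitaryLike (U₀ x ν)) (hU₁ : ∀ x ν, UnitaryLike (U₁ x ν))
    (hq₁ : PlaqSup L z (fun y ρ ν => ‖(plaq U₁ y ρ ν : R) - 1‖) q₁)
    (hq₀ : PlaqSup L z (fun y ρ ν => ‖(plaq U₀ y ρ ν : R) - 1‖) q₀) (hq : 0 ≤ q₁ + q₀)
    (hn₁ : ∀ x ν, InBlock L z x → ‖(W₁ x ν : R)‖ ≤ n₁)
    (ht₁ : ∀ x ν, InBlock L z x → ‖(W₁ x ν : R) - 1‖ ≤ t₁)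
    (ht₀ : ∀ x ν, InBlock L z x → ‖(W₀ x ν : R) - 1‖ ≤ t₀)
    (hM : ∀ x ν, InBlock L z x → ‖(((W₀ x ν)⁻¹ : Rˣ) : R)‖ ≤ M)
    (x : Site d) (ν : Fin d) (hx : InBlock L z x) (hxν : InBlock L z (x + e ν)) :
    ‖((gaugeAct (combGauge U₀ U₁ z) (fmul W₁ U₁) x ν * (fmul W₀ U₀ x ν)⁻¹ : Rˣ) : R) - 1‖ ≤
      M * (n₁ * (((d : ℝ) - 1) * ((L : ℝ) - 1) * (q₁ + q₀)) + t₁ + t₀) :=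
  factorised_defect_bound_abs hU₀ hU₁ (interior_bound_crude hU₀ hU₁ hq₁ hq₀ hq x ν hx hxν) (hn₁ x ν hx) (ht₁ x ν hx)
    (ht₀ x ν hx) (hM x ν hx)

/-- [folklore] BLOCK FORM, CRUDE UNITARY INPUT, RELATIVE DATA — THE DROP-IN: EXACTLY the hypotheses of
`T4RelativeCombWindow.factorised_interior_bound_crude` (same names, same order), conclusion
`M·(n₁·(d−1)(L−1)(q₁+q₀) + w + 2·t₀)` in place of its `… + w + 4·t₀`. -/
theorem factorised_interior_bound_crude_two [NormOneClass R] {U₀ U₁ W₀ W₁ : Cfg d R} {z : Site d} {L : ℕ}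
    {q₀ q₁ n₁ w t₀ M : ℝ} (hU₀ : ∀ x ν, UnitaryLike (U₀ x ν)) (hU₁ : ∀ x ν, UnitaryLike (U₁ x ν))
    (hq₁ : PlaqSup L z (fun y ρ ν => ‖(plaq U₁ y ρ ν : R) - 1‖) q₁)
    (hq₀ : PlaqSup L z (fun y ρ ν => ‖(plaq U₀ y ρ ν : R) - 1‖) q₀) (hq : 0 ≤ q₁ + q₀)
    (hn₁ : ∀ x ν, InBlock L z x → ‖(W₁ x ν : R)‖ ≤ n₁)
    (hw : ∀ x ν, InBlock L z x → ‖(W₁ x ν : R) - W₀ x ν‖ ≤ w)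
    (ht₀ : ∀ x ν, InBlock L z x → ‖(W₀ x ν : R) - 1‖ ≤ t₀)
    (hM : ∀ x ν, InBlock L z x → ‖(((W₀ x ν)⁻¹ : Rˣ) : R)‖ ≤ M)
    (x : Site d) (ν : Fin d) (hx : InBlock L z x) (hxν : InBlock L z (x + e ν)) :
    ‖((gaugeAct (combGauge U₀ U₁ z) (fmul W₁ U₁) x ν * (fmul W₀ U₀ x ν)⁻¹ : Rˣ) : R) - 1‖ ≤
      M * (n₁ * (((d : ℝ) - 1) * ((L : ℝ) - 1) * (q₁ + q₀)) + w + 2 * t₀) :=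
  factorised_defect_bound_two hU₀ hU₁ (interior_bound_crude hU₀ hU₁ hq₁ hq₀ hq x ν hx hxν) (hn₁ x ν hx) (hw x ν hx)
    (ht₀ x ν hx) (hM x ν hx)

/-- [folklore] BLOCK FORM, FINE UNITARY INPUT, ABSOLUTE DATA: the hypotheses of `T4RelativeComb.interior_bound_fine`
(`‖U₁ − U₀‖ ≤ ε` on the block, plaquette deviation `≤ p`, base curvature `≤ q`) and absolute window data give
`‖(𝐔₁^g)(b)·𝐔₀(b)⁻¹ − 1‖ ≤ M·(n₁·(d−1)(L−1)(p + 2d(L−1)ε·q) + t₁ + t₀)` — the transport size `d(L−1)ε` enters ONLY through the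
unitary bound, not multiplied against the complex factor. -/
theorem factorised_interior_bound_fine_abs [NormOneClass R] {U₀ U₁ W₀ W₁ : Cfg d R} {z : Site d} {L : ℕ}
    {p q ε n₁ t₁ t₀ M : ℝ} (hU₀ : ∀ x ν, UnitaryLike (U₀ x ν)) (hU₁ : ∀ x ν, UnitaryLike (U₁ x ν)) (hε : 0 ≤ ε)
    (hdev : ∀ x ν, InBlock L z x → InBlock L z (x + e ν) → ‖(U₁ x ν : R) - U₀ x ν‖ ≤ ε)
    (hp : PlaqSup L z (fun y ρ ν => ‖(plaq U₁ y ρ ν : R) - plaq U₀ y ρ ν‖) p)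
    (hq : PlaqSup L z (fun y ρ ν => ‖(plaq U₀ y ρ ν : R) - 1‖) q)
    (hpq : 0 ≤ p + 2 * ((d : ℝ) * ((L : ℝ) - 1) * ε) * q)
    (hn₁ : ∀ x ν, InBlock L z x → ‖(W₁ x ν : R)‖ ≤ n₁)
    (ht₁ : ∀ x ν, InBlock L z x → ‖(W₁ x ν : R) - 1‖ ≤ t₁)
    (ht₀ : ∀ x ν, InBlock L z x → ‖(W₀ x ν : R) - 1‖ ≤ t₀)
    (hM : ∀ x ν, InBlock L z x → ‖(((W₀ x ν)⁻¹ : Rˣ) : R)‖ ≤ M)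
    (x : Site d) (ν : Fin d) (hx : InBlock L z x) (hxν : InBlock L z (x + e ν)) :
    ‖((gaugeAct (combGauge U₀ U₁ z) (fmul W₁ U₁) x ν * (fmul W₀ U₀ x ν)⁻¹ : Rˣ) : R) - 1‖ ≤
      M * (n₁ * (((d : ℝ) - 1) * ((L : ℝ) - 1) * (p + 2 * ((d : ℝ) * ((L : ℝ) - 1) * ε) * q)) + t₁ + t₀) :=
  factorised_defect_bound_abs hU₀ hU₁ (interior_bound_fine hU₀ hU₁ hε hdev hp hq hpq x ν hx hxν) (hn₁ x ν hx)
    (ht₁ x ν hx) (ht₀ x ν hx) (hM x ν hx)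

/-- [folklore] BLOCK FORM, FINE UNITARY INPUT, RELATIVE DATA: EXACTLY the hypotheses of
`T4RelativeCombWindow.factorised_interior_bound_fine` (same names, same order), conclusion `… + w + 2·t₀` in place of its
`… + w + 2·(d(L−1)ε)·t₀` — an improvement iff `d(L−1)ε > 1` (HONEST: for small transport the Window form is the sharper one). -/
theorem factorised_interior_bound_fine_two [NormOneClass R] {U₀ U₁ W₀ W₁ : Cfg d R} {z : Site d} {L : ℕ}
    {p q ε n₁ w t₀ M : ℝ} (hU₀ : ∀ x ν, UnitaryLike (U₀ x ν)) (hU₁ : ∀ x ν, UnitaryLike (U₁ x ν)) (hε : 0 ≤ ε)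
    (hdev : ∀ x ν, InBlock L z x → InBlock L z (x + e ν) → ‖(U₁ x ν : R) - U₀ x ν‖ ≤ ε)
    (hp : PlaqSup L z (fun y ρ ν => ‖(plaq U₁ y ρ ν : R) - plaq U₀ y ρ ν‖) p)
    (hq : PlaqSup L z (fun y ρ ν => ‖(plaq U₀ y ρ ν : R) - 1‖) q)
    (hpq : 0 ≤ p + 2 * ((d : ℝ) * ((L : ℝ) - 1) * ε) * q)
    (hn₁ : ∀ x ν, InBlock L z x → ‖(W₁ x ν : R)‖ ≤ n₁)
    (hw : ∀ x ν, InBlock L z x → ‖(W₁ x ν : R) - W₀ x ν‖ ≤ w)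
    (ht₀ : ∀ x ν, InBlock L z x → ‖(W₀ x ν : R) - 1‖ ≤ t₀)
    (hM : ∀ x ν, InBlock L z x → ‖(((W₀ x ν)⁻¹ : Rˣ) : R)‖ ≤ M)
    (x : Site d) (ν : Fin d) (hx : InBlock L z x) (hxν : InBlock L z (x + e ν)) :
    ‖((gaugeAct (combGauge U₀ U₁ z) (fmul W₁ U₁) x ν * (fmul W₀ U₀ x ν)⁻¹ : Rˣ) : R) - 1‖ ≤
      M * (n₁ * (((d : ℝ) - 1) * ((L : ℝ) - 1) * (p + 2 * ((d : ℝ) * ((L : ℝ) - 1) * ε) * q)) + w + 2 * t₀) :=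
  factorised_defect_bound_two hU₀ hU₁ (interior_bound_fine hU₀ hU₁ hε hdev hp hq hpq x ν hx hxν) (hn₁ x ν hx)
    (hw x ν hx) (ht₀ x ν hx) (hM x ν hx)

/-- [folklore] **BOND-DEVIATION FORM, ABSOLUTE DATA** (the shape `T4BlockTransport.block_transport` consumes through `hCδ`):
with `‖W₀(b)‖ ≤ n₀` on the block, `‖(𝐔₁^g)(b) − 𝐔₀(b)‖ ≤ n₀·M·(n₁·(d−1)(L−1)(q₁+q₀) + t₁ + t₀)` on interior bonds
(`‖𝐔₀(b)‖ ≤ n₀·1`, `norm_fmul_le`). -/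
theorem factorised_bond_deviation_abs [NormOneClass R] {U₀ U₁ W₀ W₁ : Cfg d R} {z : Site d} {L : ℕ}
    {q₀ q₁ n₀ n₁ t₁ t₀ M : ℝ} (hU₀ : ∀ x ν, UnitaryLike (U₀ x ν)) (hU₁ : ∀ x ν, UnitaryLike (U₁ x ν))
    (hq₁ : PlaqSup L z (fun y ρ ν => ‖(plaq U₁ y ρ ν : R) - 1‖) q₁)
    (hq₀ : PlaqSup L z (fun y ρ ν => ‖(plaq U₀ y ρ ν : R) - 1‖) q₀) (hq : 0 ≤ q₁ + q₀)
    (hn₁ : ∀ x ν, InBlock L z x → ‖(W₁ x ν : R)‖ ≤ n₁)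
    (ht₁ : ∀ x ν, InBlock L z x → ‖(W₁ x ν : R) - 1‖ ≤ t₁)
    (ht₀ : ∀ x ν, InBlock L z x → ‖(W₀ x ν : R) - 1‖ ≤ t₀)
    (hM : ∀ x ν, InBlock L z x → ‖(((W₀ x ν)⁻¹ : Rˣ) : R)‖ ≤ M)
    (hn₀ : ∀ x ν, InBlock L z x → ‖(W₀ x ν : R)‖ ≤ n₀)
    (x : Site d) (ν : Fin d) (hx : InBlock L z x) (hxν : InBlock L z (x + e ν)) :
    ‖(gaugeAct (combGauge U₀ U₁ z) (fmul W₁ U₁) x ν : R) - fmul W₀ U₀ x ν‖ ≤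
      n₀ * (M * (n₁ * (((d : ℝ) - 1) * ((L : ℝ) - 1) * (q₁ + q₀)) + t₁ + t₀)) :=
  norm_sub_le_of_pert_bound (U := fmul W₀ U₀) (V := gaugeAct (combGauge U₀ U₁ z) (fmul W₁ U₁))
    (factorised_interior_bound_crude_abs hU₀ hU₁ hq₁ hq₀ hq hn₁ ht₁ ht₀ hM x ν hx hxν)
    ((norm_fmul_le W₀ (hU₀ x ν)).trans (hn₀ x ν hx))

/-- [folklore] **BOND-DEVIATION FORM, RELATIVE DATA — THE DROP-IN FOR `T4BlockTransport.factorised_bond_bound`**: EXACTLY its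
hypothesis list (same names, same order: `hU₀ hU₁ hq₁ hq₀ hq hn₁ hwd ht₀ hM hn₀ x ν hx hxν`), conclusion
`n₀·(M·(n₁·(d−1)(L−1)(q₁+q₀) + wd + 2·t₀))` in place of its `n₀·(M·(… + wd + 4·t₀))`; feeding it to `block_transport` /
`relGauge_of_blockGauge` in place of `factorised_bond_bound` tightens `block_transport_factorised` / `relGauge_factorised`
verbatim (that file is the t4-ne1p-p1 lineage's; not edited here). -/
theorem factorised_bond_deviation_two [NormOneClass R] {U₀ U₁ W₀ W₁ : Cfg d R} {z : Site d} {L : ℕ}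
    {q₀ q₁ n₀ n₁ wd t₀ M : ℝ} (hU₀ : ∀ x ν, UnitaryLike (U₀ x ν)) (hU₁ : ∀ x ν, UnitaryLike (U₁ x ν))
    (hq₁ : PlaqSup L z (fun y ρ ν => ‖(plaq U₁ y ρ ν : R) - 1‖) q₁)
    (hq₀ : PlaqSup L z (fun y ρ ν => ‖(plaq U₀ y ρ ν : R) - 1‖) q₀) (hq : 0 ≤ q₁ + q₀)
    (hn₁ : ∀ x ν, InBlock L z x → ‖(W₁ x ν : R)‖ ≤ n₁)
    (hwd : ∀ x ν, InBlock L z x → ‖(W₁ x ν : R) - W₀ x ν‖ ≤ wd)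
    (ht₀ : ∀ x ν, InBlock L z x → ‖(W₀ x ν : R) - 1‖ ≤ t₀)
    (hM : ∀ x ν, InBlock L z x → ‖(((W₀ x ν)⁻¹ : Rˣ) : R)‖ ≤ M)
    (hn₀ : ∀ x ν, InBlock L z x → ‖(W₀ x ν : R)‖ ≤ n₀)
    (x : Site d) (ν : Fin d) (hx : InBlock L z x) (hxν : InBlock L z (x + e ν)) :
    ‖(gaugeAct (combGauge U₀ U₁ z) (fmul W₁ U₁) x ν : R) - fmul W₀ U₀ x ν‖ ≤
      n₀ * (M * (n₁ * (((d : ℝ) - 1) * ((L : ℝ) - 1) * (q₁ + q₀)) + wd + 2 * t₀)) :=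
  norm_sub_le_of_pert_bound (U := fmul W₀ U₀) (V := gaugeAct (combGauge U₀ U₁ z) (fmul W₁ U₁))
    (factorised_interior_bound_crude_two hU₀ hU₁ hq₁ hq₀ hq hn₁ hwd ht₀ hM x ν hx hxν)
    ((norm_fmul_le W₀ (hU₀ x ν)).trans (hn₀ x ν hx))

/-- [folklore] COMPARISON OF THE CONSTANTS (arithmetic only): with `t₀ ≥ 0` the new relative constant is at most Window-crude's,
`n₁δ + w + 2t₀ ≤ n₁δ + w + 4t₀`, and the absolute one at most the new relative one as soon as `t₁ ≤ w + t₀`. -/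
theorem two_le_four_form {n₁ δ w t₀ : ℝ} (ht₀ : 0 ≤ t₀) : n₁ * δ + w + 2 * t₀ ≤ n₁ * δ + w + 4 * t₀ := by linarith

/-- [folklore] … and `n₁δ + t₁ + t₀ ≤ n₁δ + w + 2t₀` when `t₁ ≤ w + t₀`. -/
theorem abs_le_two_form {n₁ δ t₁ w t₀ : ℝ} (ht₁ : t₁ ≤ w + t₀) : n₁ * δ + t₁ + t₀ ≤ n₁ * δ + w + 2 * t₀ := by linarith

/-- [folklore] SHARPNESS OF THE ABSOLUTE ONE-BLOCK FORM in the complex factor of `1`: equal unitary parts (`g = 1`,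
`combGauge_self`), `W₀ = 1`, `W₁ ≡ c` constant: the left-hand side IS `‖c − 1‖` and the bound with `δ = 0`, `n₁ = ‖c‖`,
`t₁ = ‖c − 1‖`, `t₀ = 0`, `M = 1` is `1·(‖c‖·0 + ‖c − 1‖ + 0) = ‖c − 1‖` — attained. -/
theorem one_block_abs_attained [NormOneClass R] {U : Cfg d R} (hU : ∀ x ν, UnitaryLike (U x ν)) (c : Rˣ) (z x : Site d)
    (ν : Fin d) :
    ‖((gaugeAct (combGauge U U z) (fmul (fun _ _ => c) U) x ν * (fmul (fun _ _ => (1 : Rˣ)) U x ν)⁻¹ : Rˣ) : R) - 1‖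
        = ‖(c : R) - 1‖ ∧
      ‖((gaugeAct (combGauge U U z) (fmul (fun _ _ => c) U) x ν * (fmul (fun _ _ => (1 : Rˣ)) U x ν)⁻¹ : Rˣ) : R) - 1‖
        ≤ 1 * (‖(c : R)‖ * 0 + ‖(c : R) - 1‖ + 0) := by
  have hg : ∀ y, combGauge U U z y = 1 := fun y => combGauge_self U z y
  refine ⟨?_, ?_⟩
  · simp only [gaugeAct, T4RelativeCombWindow.fmul_apply, hg, one_mul, inv_one, mul_one]
    rw [Units.val_mul, Units.val_mul, Units.mul_inv_cancel_right]
  · refine factorised_defect_bound_abs (δ := 0) hU hU ?_ le_rfl le_rfl (by simp) (by simp)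
    have hd : defect U U z x ν = 1 := by
      simp [T4RelativeComb.defect, gaugeAct, hg]
    rw [hd]
    simp

end OneBlock

end Literature.MathematicalPhysics.QuantumFieldTheory.Balaban1983to89.T4MultilevelCombFactorised
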